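import Mathlib
import Summits.NavierStokesRegularity.NavierStokesRegularity.Theorems.LerayQuarterDissipationFiniteDissipationLiouvilleWindowRecurrence
import HarnessLib

/-!
# Crux `FiniteDissipationLiouville` (stmt-NavierStokesRegularity-22144): A FAST BLOB OF DEFINITE
# SIZE IN EVERY WINDOW — the super-self-similar set has INTERIOR at every scale

Theorems file of route `LerayQuarterDissipation` (lead prover g19; `--supports` the crux; sequel of
`…WindowSocket` / `…WindowRecurrence`). Navier–Stokes regularity is NOT proved by anything here; no
summit is.

`…WindowRecurrence` / `…WindowCollar`: the fast set `{√(−t)‖u‖ > 1 (+δ)}` of the hypothetical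
singular enveloped Type-I field meets every window `[−c², −εc²] × ℝ³` in a set of volume `≥ η c⁵`.
For the VELOCITY read-out the KNSS convergence of `…Compactness.seqLimit` is UNIFORM on the slab
pieces (not only pointwise), and the compactness argument then yields interior, not only measure:

* **`fastBlob_in_unit_window`** — for every `A` there are `ε = ε(A) ∈ (0,1)`, a RELATIVE SIZE
  `ρ = ρ(A) > 0` and a MARGIN `δ = δ(A) > 0` such that every SINGULAR KNSS-gauge Type-I field
  (`IsTypeIAncientMild C V`, `C ≤ A`) with a Type-I envelope `HasTypeIDecay A V` contains a whole
  parabolic cylinder `[t₀ − ρ², t₀] × B(x₀, ρ)` with `[t₀ − ρ², t₀] ⊆ [−1, −ε]` on which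
  `√(−t)‖V(t,x)‖ > 1 + δ`;
* **`fastBlob_in_every_window`** — by scale invariance of the class: for every `c > 0` a cylinder
  `[t₀ − (ρc)², t₀] × B(x₀, ρc)` inside the window `[−c², −εc²]` filled with fluid of speed
  `> (1+δ)/√(−t)`: **at every scale the hypothetical blow-up carries a COHERENT BLOB of
  super-self-similar fluid of definite relative size** (in particular the fast set has non-empty
  interior of inradius `≥ ρ(A)c` in every window — which implies the volume floor `…speed_exceeds_one_volume_scaled`
  up to constants, and the bounded gaps).

Proof: if singular members `u_j` (unit scale) had no such cylinder for `(ε_j, ρ_j, δ_j) → 0`, a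
KNSS limit `W` (Type-I `A`, envelope `A`, singular by persistence under the one law of the enveloped
class) would satisfy `√(−t)‖W‖ ≤ 1` on `(−1,0) × ℝ³`: at a point with `√(−t₀)‖W(t₀,x₀)‖ > 1` joint
continuity gives a closed ball where the speed of `W` exceeds `1 + μ`, UNIFORM convergence on the
slab piece containing it makes the speed of `u_j` exceed `1 + μ/2` there for all large `j`, and for
`j` larger still the cylinder of size `ρ_j` at `(t₀, x₀)` lies inside that ball and inside the
window `[−1, −ε_j]` while `δ_j < μ/2` — contradicting the choice of `u_j`. Then
`…LocalBalance.not_singular_of_speed_le_one_near_apex` (lead g18) says `W` is not singular.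

HONEST FRAMING. One more compactness corollary (ineffective `ε, ρ, δ`) about a HYPOTHETICAL
object; for the gradient-level read-outs (local balances, super-caloricity) the packaged KNSS
convergence of second derivatives is pointwise only, so their blob versions are not claimed.
Nothing is removed from the DSS wall (`∀ c>1 TypeIDSSLiouville c`, NECESSARY for the crux).
Nothing here bears on NS regularity.

References: Koch–Nadirashvili–Seregin–Šverák, Acta Math. 203 (2009) §4; folklore.
-/

noncomputable section

set_option linter.dupNamespace false

namespace Summit.NavierStokesRegularity.NavierStokesRegularity.Theorems.FiniteDissipationLiouville.WindowRecurrence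

open MeasureTheory Set Filter Topology Metric InnerProductSpace Function Real
open scoped RealInnerProductSpace ContDiff ENNReal
open Literature.Analysis Literature.Analysis.FluidPDE
open Summit.NavierStokesRegularity.NavierStokesRegularity.Theorems
open Summit.NavierStokesRegularity.NavierStokesRegularity.Theorems.RecurrentReductionD
open Summit.NavierStokesRegularity.NavierStokesRegularity.Theorems.FiniteDissipationLiouville
open Summit.NavierStokesRegularity.NavierStokesRegularity.Theorems.FiniteDissipationLiouville.CrossFlow
open Summit.NavierStokesRegularity.NavierStokesRegularity.Theorems.FiniteDissipationLiouville.LambProduct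
open Summit.NavierStokesRegularity.NavierStokesRegularity.Theorems.FiniteDissipationLiouville.LocalBalance
open Summit.NavierStokesRegularity.NavierStokesRegularity.Theorems.FiniteDissipationLiouville.WindowSocket

/-! ### The speed is jointly continuous; a super-threshold point has a super-threshold ball -/

section Continuity

/-- At a point of the open past where `√(−t)‖W‖ > 1` there are `r, μ > 0` with `√(−t)‖W‖ > 1 + μ`
on the ball of radius `r` (product metric), the ball staying inside `(−1, 0)` in time when
`−1 < t₀ < 0`. [folklore] -/
theorem exists_ball_speed_gt {C : ℝ} {W : ℝ → EuclideanSpace ℝ (Fin 3) → EuclideanSpace ℝ (Fin 3)}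
    (hW : IsTypeIAncientMild C W) {t₀ : ℝ} (h1 : -1 < t₀) (ht₀ : t₀ < 0)
    {x₀ : EuclideanSpace ℝ (Fin 3)} (hfast : 1 < Real.sqrt (-t₀) * ‖W t₀ x₀‖) :
    ∃ r : ℝ, 0 < r ∧ r < 1 ∧ r < t₀ + 1 ∧ r < -t₀ ∧ ∃ μ : ℝ, 0 < μ ∧
      ∀ p : ℝ × EuclideanSpace ℝ (Fin 3), dist p (t₀, x₀) < r →
        1 + μ < Real.sqrt (-p.1) * ‖W p.1 p.2‖ := by
  set f : ℝ × EuclideanSpace ℝ (Fin 3) → ℝ := fun p => Real.sqrt (-p.1) * ‖W p.1 p.2‖ with hf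
  have hcont : ContinuousOn f (Iio 0 ×ˢ univ) :=
    (continuous_fst.neg.sqrt).continuousOn.mul (continuousOn_val hW).norm
  have hmem : (t₀, x₀) ∈ Iio (0:ℝ) ×ˢ (univ : Set (EuclideanSpace ℝ (Fin 3))) := ⟨ht₀, mem_univ _⟩
  have hopen : IsOpen (Iio (0:ℝ) ×ˢ (univ : Set (EuclideanSpace ℝ (Fin 3)))) :=
    isOpen_Iio.prod isOpen_univ
  have hca : ContinuousAt f (t₀, x₀) := hcont.continuousAt (hopen.mem_nhds hmem)
  set μ : ℝ := (f (t₀, x₀) - 1) / 2 with hμ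
  have hμpos : 0 < μ := by rw [hμ]; simp only [hf] at *; linarith
  -- `f > f(p₀) − μ = 1 + μ` near `p₀`
  have hev : ∀ᶠ p in 𝓝 (t₀, x₀), f (t₀, x₀) - μ < f p :=
    hca.eventually (lt_mem_nhds (by linarith))
  obtain ⟨r₁, hr₁, hball⟩ := Metric.eventually_nhds_iff.1 hev
  set r : ℝ := min r₁ (min (1 / 2) (min ((t₀ + 1) / 2) (-t₀ / 2))) with hr
  have hrpos : 0 < r := lt_min hr₁ (lt_min (by norm_num) (lt_min (by linarith) (by linarith)))
  refine ⟨r, hrpos, ?_, ?_, ?_, μ, hμpos, fun p hp => ?_⟩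
  · have : r ≤ 1 / 2 := (min_le_right _ _).trans (min_le_left _ _); linarith
  · have : r ≤ (t₀ + 1) / 2 := (min_le_right _ _).trans ((min_le_right _ _).trans (min_le_left _ _))
    linarith
  · have : r ≤ -t₀ / 2 := (min_le_right _ _).trans ((min_le_right _ _).trans (min_le_right _ _))
    linarith
  · have hp' : dist p (t₀, x₀) < r₁ := hp.trans_le (min_le_left _ _)
    have := hball hp'
    have e : f (t₀, x₀) - μ = 1 + μ := by rw [hμ]; ring
    rw [e] at this
    exact this

end Continuity

/-! ### The blob at unit scale -/

section Blob

/-- **A FAST BLOB OF DEFINITE SIZE IN THE UNIT WINDOW.** See the module docstring.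
[folklore compactness; cite: KochNadirashviliSereginSverak2009, §4 (arXiv:0709.3599 p. 8)] -/
theorem fastBlob_in_unit_window (A : ℝ) : ∃ ε : ℝ, 0 < ε ∧ ε < 1 ∧ ∃ ρ : ℝ, 0 < ρ ∧ ∃ δ : ℝ, 0 < δ ∧
    ∀ (C : ℝ) (V : ℝ → EuclideanSpace ℝ (Fin 3) → EuclideanSpace ℝ (Fin 3)),
      IsTypeIAncientMild C V → C ≤ A → HasTypeIDecay A V →
      (∀ r > 0, ∀ M : ℝ, ∃ t ∈ Ioo (-(r ^ 2)) (0 : ℝ),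
        ∃ x ∈ ball (0 : EuclideanSpace ℝ (Fin 3)) r, M < ‖V t x‖) →
      ∃ (t₀ : ℝ) (x₀ : EuclideanSpace ℝ (Fin 3)), Icc (t₀ - ρ ^ 2) t₀ ⊆ Icc (-1 : ℝ) (-ε) ∧
        ∀ t ∈ Icc (t₀ - ρ ^ 2) t₀, ∀ x ∈ ball x₀ ρ, 1 + δ < Real.sqrt (-t) * ‖V t x‖ := by
  by_contra hcon
  push Not at hcon
  -- ## for every `j`: a singular enveloped member without a blob of size `1/(j+2)`
  have hbad : ∀ j : ℕ, ∃ u : ℝ → EuclideanSpace ℝ (Fin 3) → EuclideanSpace ℝ (Fin 3),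
      IsTypeIAncientMild A u ∧ HasTypeIDecay A u ∧
      (∀ r > 0, ∀ M : ℝ, ∃ t ∈ Ioo (-(r ^ 2)) (0 : ℝ),
        ∃ x ∈ ball (0 : EuclideanSpace ℝ (Fin 3)) r, M < ‖u t x‖) ∧
      ∀ (t₀ : ℝ) (x₀ : EuclideanSpace ℝ (Fin 3)),
        Icc (t₀ - (1 / ((j : ℝ) + 2)) ^ 2) t₀ ⊆ Icc (-1 : ℝ) (-(1 / ((j : ℝ) + 2))) →
        ∃ t ∈ Icc (t₀ - (1 / ((j : ℝ) + 2)) ^ 2) t₀, ∃ x ∈ ball x₀ (1 / ((j : ℝ) + 2)),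
          Real.sqrt (-t) * ‖u t x‖ ≤ 1 + 1 / ((j : ℝ) + 2) := by
    intro j
    obtain ⟨C, V, hV, hCA, hdec, hsing, hno⟩ := hcon (1 / ((j : ℝ) + 2)) (eps_seq_mem j).1
      (eps_seq_mem j).2 (1 / ((j : ℝ) + 2)) (eps_seq_mem j).1 (1 / ((j : ℝ) + 2)) (eps_seq_mem j).1
    exact ⟨V, isTypeIAncientMild_of_le hV hCA, hdec, hsing, hno⟩
  choose u hu hdu hsu hno using hbad
  obtain ⟨K, hK⟩ := exists_uniform_law_of_envelope A
  have hlaw : ∀ j, ∀ s : ℝ, s < 0 →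
      ∫⁻ x, ‖fderiv ℝ (u j s) x‖ₑ ^ 2 ≤ ENNReal.ofReal (K / Real.sqrt (-s)) := fun j => hK (hu j) (hdu j)
  obtain ⟨ψ, hψ, W, hW, hunif, hpt, hgr⟩ := Compactness.seqLimit hu
  have hψt : Tendsto ψ atTop atTop := hψ.tendsto_atTop
  have hdW : HasTypeIDecay A W := hasTypeIDecay_of_tendsto (fun j => hdu (ψ j)) hpt
  have hWsing := Compactness.persistent_singularity_seq (w := fun j => u (ψ j))
    (fun j => hu _) (fun j => hlaw _) (fun j => hsu _) hW hunif
  -- ## the limit is sub-threshold on `(−1, 0) × ℝ³`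
  have hslow : ∀ t : ℝ, -1 < t → t < 0 → ∀ x, Real.sqrt (-t) * ‖W t x‖ ≤ 1 := by
    intro t₀ h1 ht₀ x₀
    by_contra hfast
    push Not at hfast
    obtain ⟨r, hr, hr1, hrt1, hrt2, μ, hμ, hball⟩ := exists_ball_speed_gt hW h1 ht₀ hfast
    -- the slab piece containing the closed ball
    obtain ⟨n, hn⟩ : ∃ n : ℕ, 1 / (-(t₀ + r)) + ‖x₀‖ ≤ (n : ℝ) := exists_nat_ge _
    have hn0 : (0 : ℝ) ≤ n := n.cast_nonneg
    have htr : 0 < -(t₀ + r) := by linarith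
    have hpiece : ∀ p : ℝ × EuclideanSpace ℝ (Fin 3), dist p (t₀, x₀) < r →
        p ∈ Icc (-((n : ℝ) + 2)) (-(1 / ((n : ℝ) + 2))) ×ˢ
          closedBall (0 : EuclideanSpace ℝ (Fin 3)) ((n : ℝ) + 2) := by
      intro p hp
      have hpt : dist p.1 t₀ < r := lt_of_le_of_lt (by rw [Prod.dist_eq]; exact le_max_left _ _) hp
      have hpx : dist p.2 x₀ < r := lt_of_le_of_lt (by rw [Prod.dist_eq]; exact le_max_right _ _) hp
      rw [Real.dist_eq] at hpt
      have hpt1 := (abs_lt.1 hpt).1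
      have hpt2 := (abs_lt.1 hpt).2
      refine ⟨⟨by linarith, ?_⟩, ?_⟩
      · -- `p.1 ≤ t₀ + r ≤ −1/(n+2)`
        have hinv : 1 / (-(t₀ + r)) ≤ (n : ℝ) + 2 := by linarith [norm_nonneg x₀]
        rw [div_le_iff₀ htr] at hinv
        have : 1 / ((n : ℝ) + 2) ≤ -(t₀ + r) := by
          rw [div_le_iff₀ (by positivity)]; linarith
        linarith
      · rw [mem_closedBall, dist_zero_right]
        calc ‖p.2‖ ≤ ‖x₀‖ + dist p.2 x₀ := by
              rw [dist_eq_norm]; linarith [norm_le_norm_add_norm_sub' p.2 x₀, norm_sub_rev p.2 x₀]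
          _ ≤ (n : ℝ) + 2 := by
              have : 0 ≤ 1 / (-(t₀ + r)) := by positivity
              linarith
    -- uniform convergence on the piece: eventually the speed of `u (ψ j)` exceeds `1 + μ/2` on the ball
    have hev1 : ∀ᶠ j in atTop, ∀ p : ℝ × EuclideanSpace ℝ (Fin 3), dist p (t₀, x₀) < r →
        1 + μ / 2 < Real.sqrt (-p.1) * ‖u (ψ j) p.1 p.2‖ := by
      have h := (Metric.tendstoUniformlyOn_iff.1 (hunif n)) (μ / 2) (by positivity)
      filter_upwards [h] with j hj p hp
      have hz := hj p (hpiece p hp)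
      rw [dist_eq_norm] at hz
      have hpt : dist p.1 t₀ < r := lt_of_le_of_lt (by rw [Prod.dist_eq]; exact le_max_left _ _) hp
      rw [Real.dist_eq] at hpt
      have hp0 : 0 < -p.1 := by linarith [(abs_lt.1 hpt).2]
      have hp1 : -p.1 ≤ 1 := by linarith [(abs_lt.1 hpt).1]
      have hs1 : Real.sqrt (-p.1) ≤ 1 := Real.sqrt_le_one.mpr hp1 |>.trans_eq' rfl
      have hs0 : 0 ≤ Real.sqrt (-p.1) := Real.sqrt_nonneg _
      have hW1 := hball p hp
      -- `√(−t)‖u‖ ≥ √(−t)(‖W‖ − μ/2) ≥ √(−t)‖W‖ − μ/2`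
      have h3 : ‖W p.1 p.2‖ - μ / 2 ≤ ‖u (ψ j) p.1 p.2‖ := by
        have := norm_sub_norm_le (W p.1 p.2) (u (ψ j) p.1 p.2)
        linarith [hz.le]
      have h4 : Real.sqrt (-p.1) * (‖W p.1 p.2‖ - μ / 2) ≤ Real.sqrt (-p.1) * ‖u (ψ j) p.1 p.2‖ :=
        mul_le_mul_of_nonneg_left h3 hs0
      have h5 : Real.sqrt (-p.1) * (μ / 2) ≤ μ / 2 := by nlinarith
      nlinarith
    -- the parameters shrink below the ball and the margin
    have hev2 : ∀ᶠ j in atTop, (1 : ℝ) / ((ψ j : ℝ) + 2) < min (μ / 2) (min r (-t₀)) :=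
      (tendsto_eps_seq hψt).eventually (gt_mem_nhds (lt_min (by positivity) (lt_min hr (by linarith))))
    obtain ⟨j, hj1, hj2⟩ := (hev1.and hev2).exists
    set ρj : ℝ := 1 / ((ψ j : ℝ) + 2) with hρj
    have hρpos : 0 < ρj := (eps_seq_mem (ψ j)).1
    have hρ1 : ρj < 1 := (eps_seq_mem (ψ j)).2
    have hρμ : ρj < μ / 2 := hj2.trans_le (min_le_left _ _)
    have hρr : ρj < r := hj2.trans_le ((min_le_right _ _).trans (min_le_left _ _))
    have hρt : ρj < -t₀ := hj2.trans_le ((min_le_right _ _).trans (min_le_right _ _))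
    have hρ2 : ρj ^ 2 < r := by nlinarith
    -- the cylinder of size `ρ_j` at `(t₀, x₀)` lies in the window `[−1, −ε_j]`
    have hwin : Icc (t₀ - ρj ^ 2) t₀ ⊆ Icc (-1 : ℝ) (-ρj) := by
      intro t ht
      exact ⟨by linarith [ht.1], by linarith [ht.2]⟩
    obtain ⟨t, ht, x, hx, hle⟩ := hno (ψ j) t₀ x₀ hwin
    -- but `(t, x)` lies in the ball where the speed exceeds `1 + μ/2 > 1 + ρ_j`
    have hdist : dist ((t, x) : ℝ × EuclideanSpace ℝ (Fin 3)) (t₀, x₀) < r := by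
      rw [Prod.dist_eq, max_lt_iff]
      refine ⟨?_, mem_ball.1 hx |>.trans hρr⟩
      change dist t t₀ < r
      rw [Real.dist_eq, abs_lt]
      exact ⟨by linarith [ht.1], by linarith [ht.2]⟩
    have hgt := hj1 (t, x) hdist
    dsimp only at hgt
    linarith
  -- ## hence the limit is not singular — contradiction
  exact not_singular_of_speed_le_one_near_apex hW hdW (τ := -1/2) (by norm_num)
    (fun t h1 h2 x => hslow t (by linarith) h2 x) hWsing

/-- **A FAST BLOB OF DEFINITE RELATIVE SIZE IN EVERY WINDOW.** With `ε(A)`, `ρ(A)`, `δ(A)` of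
`fastBlob_in_unit_window`: for every singular enveloped member and every `c > 0` there is a
parabolic cylinder `[t₀ − (ρc)², t₀] × B(x₀, ρc)` with `[t₀ − (ρc)², t₀] ⊆ [−c², −εc²]` on which
`√(−t)‖V(t,x)‖ > 1 + δ`. [folklore; cite: KochNadirashviliSereginSverak2009, §4 (arXiv:0709.3599 p. 8)] -/
theorem fastBlob_in_every_window (A : ℝ) : ∃ ε : ℝ, 0 < ε ∧ ε < 1 ∧ ∃ ρ : ℝ, 0 < ρ ∧ ∃ δ : ℝ, 0 < δ ∧
    ∀ (C : ℝ) (V : ℝ → EuclideanSpace ℝ (Fin 3) → EuclideanSpace ℝ (Fin 3)),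
      IsTypeIAncientMild C V → C ≤ A → HasTypeIDecay A V →
      (∀ r > 0, ∀ M : ℝ, ∃ t ∈ Ioo (-(r ^ 2)) (0 : ℝ),
        ∃ x ∈ ball (0 : EuclideanSpace ℝ (Fin 3)) r, M < ‖V t x‖) →
      ∀ c : ℝ, 0 < c →
      ∃ (t₀ : ℝ) (x₀ : EuclideanSpace ℝ (Fin 3)),
        Icc (t₀ - (ρ * c) ^ 2) t₀ ⊆ Icc (-c ^ 2) (-(ε * c ^ 2)) ∧
        ∀ t ∈ Icc (t₀ - (ρ * c) ^ 2) t₀, ∀ x ∈ ball x₀ (ρ * c),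
          1 + δ < Real.sqrt (-t) * ‖V t x‖ := by
  obtain ⟨ε, hε, hε1, ρ, hρ, δ, hδ, h⟩ := fastBlob_in_unit_window A
  refine ⟨ε, hε, hε1, ρ, hρ, δ, hδ, fun C V hV hCA hdec hsing c hc => ?_⟩
  obtain ⟨t₀, x₀, hwin, hfast⟩ := h C (nsRescale c V) (hV.nsRescale hc) hCA (hdec.nsRescale hc)
    (singularAtOrigin_nsRescale hsing hc)
  have hc2 : 0 < c ^ 2 := by positivity
  refine ⟨c ^ 2 * t₀, c • x₀, fun t ht => ?_, fun t ht x hx => ?_⟩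
  · have h1 := hwin ⟨le_rfl, by nlinarith⟩
    have h2 := hwin ⟨by nlinarith, le_rfl⟩
    constructor
    · nlinarith [ht.1, h1.1]
    · nlinarith [ht.2, h2.2]
  · -- pull `(t, x)` back to the unit scale
    have ht' : t / c ^ 2 ∈ Icc (t₀ - ρ ^ 2) t₀ := by
      constructor
      · rw [le_div_iff₀ hc2]; nlinarith [ht.1]
      · rw [div_le_iff₀ hc2]; nlinarith [ht.2]
    have hx' : c⁻¹ • x ∈ ball x₀ ρ := by
      rw [mem_ball, dist_eq_norm] at hx ⊢
      have e : c⁻¹ • x - x₀ = c⁻¹ • (x - c • x₀) := by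
        rw [smul_sub, smul_smul, inv_mul_cancel₀ hc.ne', one_smul]
      rw [e, norm_smul, norm_inv, Real.norm_of_nonneg hc.le, inv_mul_lt_iff₀ hc]
      linarith
    have key := hfast (t / c ^ 2) ht' (c⁻¹ • x) hx'
    have e1 : nsRescale c V (t / c ^ 2) (c⁻¹ • x) = c • V t x := by
      rw [nsRescale_apply, mul_div_cancel₀ _ hc2.ne', smul_smul, mul_inv_cancel₀ hc.ne', one_smul]
    have ht0 : t ≤ 0 := by
      have := ht.2
      have h2 := (hwin ⟨by nlinarith, le_rfl⟩).2
      nlinarith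
    have e2 : Real.sqrt (-(t / c ^ 2)) = Real.sqrt (-t) / c := by
      rw [show -(t / c ^ 2) = (-t) / c ^ 2 by ring, Real.sqrt_div' _ hc2.le, Real.sqrt_sq hc.le]
    rw [e1, e2, norm_smul, Real.norm_of_nonneg hc.le] at key
    have e3 : Real.sqrt (-t) / c * (c * ‖V t x‖) = Real.sqrt (-t) * ‖V t x‖ := by
      field_simp
    linarith [e3.symm.le, e3.le]

end Blob

end Summit.NavierStokesRegularity.NavierStokesRegularity.Theorems.FiniteDissipationLiouville.WindowRecurrence

end
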